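import Mathlib
import Literature.Computability.AlgebraicComplexity.StandardFamilies

/-!
# Crux `WordLengthQP` (stmt-ValiantsHypothesis-6623), line `Sketch` (eps-order-ladder) —
rung `q = 1` of the ε-order ladder: the ONE-WAY CASCADE normal form (Leibniz at order `ε¹`)

The open stub `stub_ladder_pos` of the line starts at the rung `q = 1`: border width-2 S-affine
programs over `ℂ[ε][x̄]` with `(0,0)` entry `ε · per_n + ε² · G`.  This file records the typed
first lemma of that rung (idea card `eps-order-ladder`, "first CONTENT statements"):
splitting every letter as `m_t = A_t♯ + ε B_t♯ + ε² R_t` with `A_t`, `B_t` S-affine over `ℂ`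
(`♯ = MvPolynomial.map Polynomial.C`), the product is
`(∏ A_t)♯ + ε · (Σ_t A₁⋯A_{t-1} B_t A_{t+1}⋯A_L)♯ + ε² · R` (Leibniz rule at order one), so an
order-1 program for `f` is exactly an EXACT S-affine skeleton `A₁ ⋯ A_L` with `(∏ A)₀₀ = 0` plus one
S-affine insertion `B_t` per position:

  `f = Σ_{t < L} (A₁ ⋯ A_{t-1} · B_t · A_{t+1} ⋯ A_L)₀₀`     (`rungOne_normal_form`).

Together with the landed rung `q = 0` structure theory (`rung0_lemmaB`, `stub_letterMachine`,
`stub_continuantTop`: rows of exact unit-determinant stretches are continuant pairs) this is the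
"(q+1)-level one-way cascade" of the idea card at `q = 1`, typed over existing declarations only.
-/

-- `Summit.ValiantsHypothesis.ValiantsHypothesis.…` is the tree's mandated single-conjunct layout
-- (Sub = Summit), so the duplicated namespace component is intended.
set_option linter.dupNamespace false

noncomputable section

open MvPolynomial

namespace Summit.ValiantsHypothesis.ValiantsHypothesis.Cruxes.WordLengthQP.EpsOrderLadder

/-- `ε`-splitting of a coefficient: `b = b₀ + ε b₁ + ε² r`. [folklore] -/
theorem rungOne_coeff_split (b : Polynomial ℂ) :
    ∃ r : Polynomial ℂ, b = Polynomial.C (b.coeff 0) + Polynomial.X * Polynomial.C (b.coeff 1) +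
      Polynomial.X ^ 2 * r := by
  have hdvd : Polynomial.X ^ 2 ∣ b - Polynomial.C (b.coeff 0) - Polynomial.X * Polynomial.C (b.coeff 1) := by
    rw [Polynomial.X_pow_dvd_iff]
    intro d hd
    interval_cases d <;> simp
  obtain ⟨r, hr⟩ := hdvd
  exact ⟨r, by linear_combination hr⟩

/-- `ε`-splitting of an S-affine letter over `ℂ[ε][x̄]`: `m = A♯ + ε • B♯ + ε² • R` with `A`
(the `ε⁰`-part, `ε ↦ 0`) and `B` S-affine over `ℂ[x̄]`. [folklore] -/
theorem rungOne_letter_split {σ : Type} (m : Matrix (Fin 2) (Fin 2) (MvPolynomial σ (Polynomial ℂ)))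
    (hm : ∀ i j : Fin 2, (∃ b : Polynomial ℂ, m i j = MvPolynomial.C b) ∨
      (∃ (a b : Polynomial ℂ) (v : σ),
        m i j = MvPolynomial.C a * MvPolynomial.X v + MvPolynomial.C b)) :
    ∃ (B : Matrix (Fin 2) (Fin 2) (MvPolynomial σ ℂ))
      (R : Matrix (Fin 2) (Fin 2) (MvPolynomial σ (Polynomial ℂ))),
      (∀ i j : Fin 2, (∃ b : ℂ, B i j = MvPolynomial.C b) ∨
        (∃ (a b : ℂ) (v : σ), B i j = MvPolynomial.C a * MvPolynomial.X v + MvPolynomial.C b)) ∧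
      m = (m.map (MvPolynomial.map (Polynomial.evalRingHom 0))).map (MvPolynomial.map Polynomial.C) +
        (MvPolynomial.C Polynomial.X : MvPolynomial σ (Polynomial ℂ)) •
          B.map (MvPolynomial.map Polynomial.C) +
        (MvPolynomial.C (Polynomial.X ^ 2) : MvPolynomial σ (Polynomial ℂ)) • R := by
  -- entrywise splitting data
  have key : ∀ i j : Fin 2, ∃ (Bij : MvPolynomial σ ℂ) (Rij : MvPolynomial σ (Polynomial ℂ)),
      ((∃ b : ℂ, Bij = MvPolynomial.C b) ∨
        (∃ (a b : ℂ) (v : σ), Bij = MvPolynomial.C a * MvPolynomial.X v + MvPolynomial.C b)) ∧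
      m i j = MvPolynomial.map Polynomial.C
          (MvPolynomial.map (Polynomial.evalRingHom 0) (m i j)) +
        MvPolynomial.C Polynomial.X * MvPolynomial.map Polynomial.C Bij +
        MvPolynomial.C (Polynomial.X ^ 2) * Rij := by
    intro i j
    rcases hm i j with ⟨b, hb⟩ | ⟨a, b, v, hab⟩
    · obtain ⟨rb, hrb⟩ := rungOne_coeff_split b
      refine ⟨MvPolynomial.C (b.coeff 1), MvPolynomial.C rb, Or.inl ⟨_, rfl⟩, ?_⟩
      rw [hb]
      simp only [MvPolynomial.map_C, Polynomial.coe_evalRingHom, ← Polynomial.coeff_zero_eq_eval_zero]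
      conv_lhs => rw [hrb]
      simp only [map_add, map_mul, map_pow]
    · obtain ⟨ra, hra⟩ := rungOne_coeff_split a
      obtain ⟨rb, hrb⟩ := rungOne_coeff_split b
      refine ⟨MvPolynomial.C (a.coeff 1) * MvPolynomial.X v + MvPolynomial.C (b.coeff 1),
        MvPolynomial.C ra * MvPolynomial.X v + MvPolynomial.C rb, Or.inr ⟨_, _, v, rfl⟩, ?_⟩
      rw [hab]
      simp only [map_add, map_mul, MvPolynomial.map_C, MvPolynomial.map_X,
        Polynomial.coe_evalRingHom, ← Polynomial.coeff_zero_eq_eval_zero]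
      conv_lhs => rw [hra, hrb]
      simp only [map_add, map_mul, map_pow]
      ring
  choose Bf Rf hBf hm' using key
  refine ⟨Matrix.of Bf, Matrix.of Rf, fun i j => by simpa using hBf i j, ?_⟩
  refine Matrix.ext fun i j => ?_
  simp only [Matrix.add_apply, Matrix.map_apply, Matrix.smul_apply, Matrix.of_apply, smul_eq_mul]
  exact hm' i j

/-- The order-one sum for a longer skeleton: `Σ_{t ≤ L} = B · (A₂⋯) + A · Σ_{t < L}`. [folklore] -/
theorem rungOne_sum_cons {σ : Type} (A B : Matrix (Fin 2) (Fin 2) (MvPolynomial σ ℂ))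
    (As Bs : List (Matrix (Fin 2) (Fin 2) (MvPolynomial σ ℂ))) :
    (∑ t ∈ Finset.range (As.length + 1),
        (((A :: As).take t).prod * (B :: Bs).getD t 0 * ((A :: As).drop (t + 1)).prod)) =
      B * As.prod + A * ∑ t ∈ Finset.range As.length,
        ((As.take t).prod * Bs.getD t 0 * (As.drop (t + 1)).prod) := by
  rw [Finset.sum_range_succ', Finset.mul_sum]
  simp only [List.take_succ_cons, List.prod_cons, List.getD_cons_succ, List.drop_succ_cons,
    List.take_zero, List.prod_nil, one_mul, List.getD_cons_zero, zero_add, List.drop_zero,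
    Matrix.mul_assoc]
  rw [add_comm]

/-- **Leibniz rule at order `ε¹` for products of width-2 matrices.**  If every letter splits as
`m_t = A_t♯ + ε • B_t♯ + ε² • R_t`, then
`∏ m_t = (∏ A_t)♯ + ε • (Σ_{t} A₁⋯A_{t-1} B_t A_{t+1}⋯A_L)♯ + ε² • R`. [folklore] -/
theorem rungOne_prod_split {σ : Type} (ms : List (Matrix (Fin 2) (Fin 2) (MvPolynomial σ (Polynomial ℂ))))
    (As Bs : List (Matrix (Fin 2) (Fin 2) (MvPolynomial σ ℂ)))
    (hlenA : As.length = ms.length) (hlenB : Bs.length = ms.length)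
    (hsplit : ∀ t : ℕ, ∀ (ht : t < ms.length), ∃ R : Matrix (Fin 2) (Fin 2) (MvPolynomial σ (Polynomial ℂ)),
      ms[t] = (As[t]'(by omega)).map (MvPolynomial.map Polynomial.C) +
        (MvPolynomial.C Polynomial.X : MvPolynomial σ (Polynomial ℂ)) •
          (Bs[t]'(by omega)).map (MvPolynomial.map Polynomial.C) +
        (MvPolynomial.C (Polynomial.X ^ 2) : MvPolynomial σ (Polynomial ℂ)) • R) :
    ∃ R : Matrix (Fin 2) (Fin 2) (MvPolynomial σ (Polynomial ℂ)),
      ms.prod = As.prod.map (MvPolynomial.map Polynomial.C) +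
        (MvPolynomial.C Polynomial.X : MvPolynomial σ (Polynomial ℂ)) •
          (∑ t ∈ Finset.range ms.length,
            ((As.take t).prod * Bs.getD t 0 * (As.drop (t + 1)).prod)).map
              (MvPolynomial.map Polynomial.C) +
        (MvPolynomial.C (Polynomial.X ^ 2) : MvPolynomial σ (Polynomial ℂ)) • R := by
  induction ms generalizing As Bs with
  | nil =>
    cases As with
    | nil =>
      refine ⟨0, ?_⟩
      simp [Matrix.map_one _ (map_zero _) (map_one _)]
    | cons _ _ => simp at hlenA
  | cons m ms ih =>
    cases As with
    | nil => simp at hlenA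
    | cons A As =>
      cases Bs with
      | nil => simp at hlenB
      | cons B Bs =>
        simp only [List.length_cons, Nat.add_right_cancel_iff] at hlenA hlenB
        obtain ⟨R₁, hR₁⟩ := hsplit 0 (by simp)
        simp only [List.getElem_cons_zero] at hR₁
        obtain ⟨R₂, hR₂⟩ := ih As Bs hlenA hlenB (fun t ht => by
          obtain ⟨R, hR⟩ := hsplit (t + 1) (by simpa using ht)
          exact ⟨R, by simpa using hR⟩)
        -- abbreviations
        set φ : MvPolynomial σ ℂ →+* MvPolynomial σ (Polynomial ℂ) := MvPolynomial.map Polynomial.C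
          with hφ
        set e : MvPolynomial σ (Polynomial ℂ) := MvPolynomial.C Polynomial.X with he
        have he2 : (MvPolynomial.C (Polynomial.X ^ 2) : MvPolynomial σ (Polynomial ℂ)) = e * e := by
          rw [he, ← map_mul, pow_two]
        set S : Matrix (Fin 2) (Fin 2) (MvPolynomial σ ℂ) :=
          ∑ t ∈ Finset.range ms.length, ((As.take t).prod * Bs.getD t 0 * (As.drop (t + 1)).prod)
          with hS
        refine ⟨A.map φ * R₂ + B.map φ * (S.map φ + e • R₂) +
          R₁ * (As.prod.map φ + e • S.map φ + (e * e) • R₂), ?_⟩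
        rw [List.prod_cons, hR₁, hR₂, List.length_cons, ← hlenA, rungOne_sum_cons, hlenA, ← hS,
          List.prod_cons, he2]
        have hmapmul : ∀ P Q : Matrix (Fin 2) (Fin 2) (MvPolynomial σ ℂ),
            (P * Q).map φ = P.map φ * Q.map φ := fun P Q => Matrix.map_mul
        have hmapadd : ∀ P Q : Matrix (Fin 2) (Fin 2) (MvPolynomial σ ℂ),
            (P + Q).map φ = P.map φ + Q.map φ := fun P Q => Matrix.map_add _ (map_add φ) P Q
        rw [hmapadd, hmapmul, hmapmul, hmapmul]
        simp only [Matrix.add_mul, Matrix.mul_add, Matrix.smul_mul, Matrix.mul_smul, smul_add,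
          smul_smul, mul_assoc]
        abel

/-- If `p♯ + ε q♯ + ε² r = ε f♯ + ε² g` in `ℂ[ε][x̄]` then `p = 0` and `q = f` (compare the
coefficients of `ε⁰` and `ε¹`). [folklore] -/
theorem rungOne_compare {σ : Type} (p q f : MvPolynomial σ ℂ) (r g : MvPolynomial σ (Polynomial ℂ))
    (h : MvPolynomial.map Polynomial.C p + MvPolynomial.C Polynomial.X * MvPolynomial.map Polynomial.C q +
      MvPolynomial.C (Polynomial.X ^ 2) * r =
      MvPolynomial.C Polynomial.X * MvPolynomial.map Polynomial.C f +
        MvPolynomial.C (Polynomial.X ^ 2) * g) :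
    p = 0 ∧ q = f := by
  set ψ : MvPolynomial σ (Polynomial ℂ) →+* MvPolynomial σ ℂ :=
    MvPolynomial.map (Polynomial.evalRingHom 0) with hψ
  have hcomp : (Polynomial.evalRingHom (0 : ℂ)).comp Polynomial.C = RingHom.id ℂ := by
    ext x; simp
  have hψφ : ∀ s : MvPolynomial σ ℂ, ψ (MvPolynomial.map Polynomial.C s) = s := fun s => by
    rw [hψ, MvPolynomial.map_map, hcomp, MvPolynomial.map_id]
  have hψe : ψ (MvPolynomial.C Polynomial.X) = 0 := by
    rw [hψ, MvPolynomial.map_C]; simp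
  have hψe2 : ψ (MvPolynomial.C (Polynomial.X ^ 2)) = 0 := by
    rw [hψ, MvPolynomial.map_C]; simp
  -- ε⁰
  have hp : p = 0 := by
    have := congrArg ψ h
    simpa only [map_add, map_mul, hψφ, hψe, hψe2, zero_mul, add_zero, zero_add] using this
  refine ⟨hp, ?_⟩
  -- ε¹: cancel one ε (the ring is a domain) and evaluate at ε = 0 again
  rw [hp, map_zero, zero_add, show MvPolynomial.C (Polynomial.X ^ 2) =
      MvPolynomial.C Polynomial.X * (MvPolynomial.C Polynomial.X : MvPolynomial σ (Polynomial ℂ)) by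
    rw [← map_mul, pow_two], mul_assoc, mul_assoc, ← mul_add, ← mul_add] at h
  have he : (MvPolynomial.C Polynomial.X : MvPolynomial σ (Polynomial ℂ)) ≠ 0 := by
    rw [Ne, MvPolynomial.C_eq_zero]; exact Polynomial.X_ne_zero
  have h' := mul_left_cancel₀ he h
  have := congrArg ψ h'
  simpa only [map_add, map_mul, hψφ, hψe, zero_mul, add_zero] using this

/-- **Rung `q = 1`: the one-way cascade normal form** (Leibniz at order `ε¹`).  If a product of
width-2 matrices over `ℂ[ε][x̄]` with S-affine entries has `(0,0)` entry `ε · f + ε² · G`, then with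
`A_t := m_t|_{ε=0}` (S-affine over `ℂ[x̄]`, the EXACT skeleton) and suitable S-affine `B_t` over
`ℂ[x̄]` (the `ε¹`-parts of the letters):
`(A₁ ⋯ A_L)₀₀ = 0` and `f = Σ_{t<L} (A₁⋯A_{t-1} · B_t · A_{t+1}⋯A_L)₀₀`. -/
theorem rungOne_normal_form {σ : Type} (f : MvPolynomial σ ℂ)
    (ms : List (Matrix (Fin 2) (Fin 2) (MvPolynomial σ (Polynomial ℂ))))
    (hS : ∀ m ∈ ms, ∀ i j : Fin 2, (∃ b : Polynomial ℂ, m i j = MvPolynomial.C b) ∨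
      (∃ (a b : Polynomial ℂ) (v : σ),
        m i j = MvPolynomial.C a * MvPolynomial.X v + MvPolynomial.C b))
    (G : MvPolynomial σ (Polynomial ℂ))
    (hF : ms.prod 0 0 = MvPolynomial.C Polynomial.X * MvPolynomial.map Polynomial.C f +
      MvPolynomial.C (Polynomial.X ^ 2) * G) :
    ∃ Bs : List (Matrix (Fin 2) (Fin 2) (MvPolynomial σ ℂ)),
      Bs.length = ms.length ∧
      (∀ B ∈ Bs, ∀ i j : Fin 2, (∃ b : ℂ, B i j = MvPolynomial.C b) ∨
        (∃ (a b : ℂ) (v : σ), B i j = MvPolynomial.C a * MvPolynomial.X v + MvPolynomial.C b)) ∧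
      (ms.map (fun m => m.map (MvPolynomial.map (Polynomial.evalRingHom 0)))).prod 0 0 = 0 ∧
      f = (∑ t ∈ Finset.range ms.length,
        (((ms.map (fun m => m.map (MvPolynomial.map (Polynomial.evalRingHom 0)))).take t).prod *
          Bs.getD t 0 *
          ((ms.map (fun m => m.map (MvPolynomial.map (Polynomial.evalRingHom 0)))).drop (t + 1)).prod))
        0 0 := by
  -- choose the splitting of every letter
  have key : ∀ m ∈ ms, ∃ (B : Matrix (Fin 2) (Fin 2) (MvPolynomial σ ℂ))
      (R : Matrix (Fin 2) (Fin 2) (MvPolynomial σ (Polynomial ℂ))),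
      (∀ i j : Fin 2, (∃ b : ℂ, B i j = MvPolynomial.C b) ∨
        (∃ (a b : ℂ) (v : σ), B i j = MvPolynomial.C a * MvPolynomial.X v + MvPolynomial.C b)) ∧
      m = (m.map (MvPolynomial.map (Polynomial.evalRingHom 0))).map (MvPolynomial.map Polynomial.C) +
        (MvPolynomial.C Polynomial.X : MvPolynomial σ (Polynomial ℂ)) •
          B.map (MvPolynomial.map Polynomial.C) +
        (MvPolynomial.C (Polynomial.X ^ 2) : MvPolynomial σ (Polynomial ℂ)) • R :=
    fun m hm => rungOne_letter_split m (hS m hm)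
  choose Bf Rf hBf hmf using key
  set As := ms.map (fun m => m.map (MvPolynomial.map (Polynomial.evalRingHom 0))) with hAs
  set Bs := ms.pmap (fun m hm => Bf m hm) (fun m hm => hm) with hBs
  have hlenA : As.length = ms.length := by simp [hAs]
  have hlenB : Bs.length = ms.length := by simp [hBs]
  obtain ⟨R, hR⟩ := rungOne_prod_split ms As Bs hlenA hlenB (fun t ht => by
    refine ⟨Rf (ms[t]) (List.getElem_mem ht), ?_⟩
    have hA : As[t]'(by omega) = (ms[t]).map (MvPolynomial.map (Polynomial.evalRingHom 0)) := by
      simp [hAs]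
    have hB : Bs[t]'(by omega) = Bf (ms[t]) (List.getElem_mem ht) := by
      simp [hBs, List.getElem_pmap]
    rw [hA, hB]
    exact hmf _ _)
  refine ⟨Bs, hlenB, fun B hB => ?_, ?_⟩
  · rw [hBs] at hB
    obtain ⟨m, hm, rfl⟩ := List.mem_pmap.1 hB
    exact hBf m hm
  · have h00 := congrFun (congrFun hR 0) 0
    rw [hF] at h00
    simp only [Matrix.add_apply, Matrix.map_apply, Matrix.smul_apply, smul_eq_mul] at h00
    obtain ⟨hp, hq⟩ := rungOne_compare _ _ f (R 0 0) G h00.symm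
    exact ⟨hp, hq.symm⟩

end Summit.ValiantsHypothesis.ValiantsHypothesis.Cruxes.WordLengthQP.EpsOrderLadder
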